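import Mathlib
import Summits.RiemannHypothesis.RiemannHypothesis.Theorems.WeilFormatCCellShiftCertA083p4
import Summits.RiemannHypothesis.RiemannHypothesis.Theorems.WeilFormatCCellShiftCertA083p4T
import Summits.RiemannHypothesis.RiemannHypothesis.Theorems.WeilFormatCCellShiftCertRange
import HarnessLib

/-!
# Kernel class parts 0–5 of the cell-refined shift certificate `cellA083p4` (+ the structural check and the merged-table check)

Helper file (`--supports stmt-RiemannHypothesis-0098`), RH-free; seat rh-explicit-weil-1 gen4.  One `decide +kernel` pair pass
per class part of `CellSOS.cellA083p4` (`WeilFormatCCellShiftCertA083p4.lean`); consumed by the bound file together with `cellA083p4_check`.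
-/

set_option linter.dupNamespace false

namespace Summit.RiemannHypothesis.RiemannHypothesis.Theorems.WeilFormatC.CellSOS

set_option maxHeartbeats 0 in
/-- The cheap structural check of `cellA083p4` (kernel). [folklore] -/
theorem cellA083p4_check : cellA083p4.check = true := by
  decide +kernel

set_option maxHeartbeats 0 in
set_option maxRecDepth 100000 in
/-- The merged claimed tables of `cellA083p4` pass the final class-bound check (kernel). [folklore] -/
theorem cellA083p4_merge : cellA083p4.checkMerge cellA083p4T = true := by
  decide +kernel

set_option maxHeartbeats 0 in
set_option maxRecDepth 100000 in
/-- Row-range part 0 of `cellA083p4`: the kernel's partial class table IS the claimed one. [folklore] -/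
theorem cellA083p4_tabR0 : cellA083p4.checkTab cellA083p4T 0 = true := by
  decide +kernel

set_option maxHeartbeats 0 in
set_option maxRecDepth 100000 in
/-- Row-range part 1 of `cellA083p4`: the kernel's partial class table IS the claimed one. [folklore] -/
theorem cellA083p4_tabR1 : cellA083p4.checkTab cellA083p4T 1 = true := by
  decide +kernel

set_option maxHeartbeats 0 in
set_option maxRecDepth 100000 in
/-- Row-range part 2 of `cellA083p4`: the kernel's partial class table IS the claimed one. [folklore] -/
theorem cellA083p4_tabR2 : cellA083p4.checkTab cellA083p4T 2 = true := by
  decide +kernel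

set_option maxHeartbeats 0 in
set_option maxRecDepth 100000 in
/-- Row-range part 3 of `cellA083p4`: the kernel's partial class table IS the claimed one. [folklore] -/
theorem cellA083p4_tabR3 : cellA083p4.checkTab cellA083p4T 3 = true := by
  decide +kernel

set_option maxHeartbeats 0 in
set_option maxRecDepth 100000 in
/-- Row-range part 4 of `cellA083p4`: the kernel's partial class table IS the claimed one. [folklore] -/
theorem cellA083p4_tabR4 : cellA083p4.checkTab cellA083p4T 4 = true := by
  decide +kernel

set_option maxHeartbeats 0 in
set_option maxRecDepth 100000 in
/-- Row-range part 5 of `cellA083p4`: the kernel's partial class table IS the claimed one. [folklore] -/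
theorem cellA083p4_tabR5 : cellA083p4.checkTab cellA083p4T 5 = true := by
  decide +kernel

end Summit.RiemannHypothesis.RiemannHypothesis.Theorems.WeilFormatC.CellSOS
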